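import Summits.HubbardSuperconductivity.HubbardSuperconductivity.Theorems.AnisotropyChordBipartiteLumping
import Summits.HubbardSuperconductivity.HubbardSuperconductivity.Theorems.AnisotropyChordSpinMonotoneTwoMagnonInvariant
import Literature.MathematicalPhysics.QuantumLattice.LiebMattisSectorPF

/-!
# Route `AnisotropyChord`: exact lumping on `K_{m,m}`, step 3 — the positive CLASS FUNCTION of a
# sector Perron vector and its birth–death equation

* `xxz_sector_perron_pos` (any connected graph): the sector of weight `W` of
  `H(Δ) = xxzHamiltonian 1 G (−1) Δ` has a ground vector `ψ₀` with REAL NON-NEGATIVE entries, STRICTLY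
  POSITIVE on the weight-`W` configurations, and every sector ground vector is a multiple of it
  (Perron–Frobenius `xxz_sector_perronFrobenius` + `sector_groundVec_pos`).
* `cb_classFun` (`K_{m,m} = completeEquipartiteGraph 2 m`): for such `ψ₀` there is `F : ℕ → ℝ` with
  `ψ₀(τ) = F(A(τ))` on the sector (`A` = down spins in part `0`; `…PartInvariance`), `F = 0` on empty
  classes, `F > 0` on nonempty ones, the MIRROR symmetry `F(W − a) = F(a)`, and the LUMPED EQUATION
  `E F(a) = −Δ(m/2 − a)(m/2 − (W−a)) F(a) − ½(a(m−W+a) F(a−1) + (m−a)(W−a) F(a+1))` on nonempty classes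
  (`cb_lumped_equation`).

This is the input of the Sturm/total-positivity step (`…BipartiteGramTP`).  Theory seat
`hubbard-h0-rotor-theory-1`, memo ROTOR-THEORY-6 §61.  No definition is introduced.
-/

set_option linter.dupNamespace false

noncomputable section

namespace Summit.HubbardSuperconductivity.HubbardSuperconductivity.Theorems.AnisotropyChord

open Matrix Complex Finset
open scoped ComplexOrder
open Literature.MathematicalPhysics.QuantumLattice Literature.Probability.LatticeModels
open Summit.HubbardSuperconductivity.HubbardSuperconductivity.Theorems.PolyaSchurPairBoson

/-! ### A strictly positive Perron vector in every sector -/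

/-- **A nonnegative sector eigenvector of a stoquastic Hamiltonian is strictly positive on its weight
sector** (connected hop graph): if `H` has real entries, nonpositive off the diagonal and nonzero along
the hops of `heisenbergHamiltonian n G 1`, `G` connected, and `ψ ≠ 0` is entrywise nonnegative real,
vanishes off the weight-`W` configurations and satisfies `H ψ = E ψ`, then `Re ψ(σ) > 0` for every `σ`
of weight `W` (a vanishing entry propagates along hops through the eigen-equation).  Transplanted from
`LevyLogBootstrap.sector_groundVec_pos` (same proof) to keep this file independent of that route's
Theses file.  Tasaki (2020) §2.4; Lieb–Wu, Physica A 321 (2003) §2. [folklore] -/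
theorem groundVec_pos_of_nonneg {Λ : Type*} [Fintype Λ] [DecidableEq Λ] (n : ℕ) (G : SimpleGraph Λ)
    [DecidableRel G.Adj] (hG : G.Connected) (H : Op Λ (n + 1))
    (hhop : ∀ σ τ : TensorIndex Λ (n + 1), σ ≠ τ → heisenbergHamiltonian n G 1 σ τ ≠ 0 → H σ τ ≠ 0)
    (hreal : ∀ σ τ : TensorIndex Λ (n + 1), star (H σ τ) = H σ τ)
    (hoff : ∀ σ τ : TensorIndex Λ (n + 1), σ ≠ τ → (H σ τ).re ≤ 0) (W : ℕ)
    {ψ : TensorIndex Λ (n + 1) → ℂ} (hψK : ∀ σ, (∑ z, (σ z : ℕ)) ≠ W → ψ σ = 0)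
    (hnn : ∀ σ, 0 ≤ (ψ σ).re ∧ (ψ σ).im = 0) {E : ℂ} (hHψ : H *ᵥ ψ = E • ψ) (hψ0 : ψ ≠ 0) :
    ∀ σ, (∑ z, (σ z : ℕ)) = W → 0 < (ψ σ).re := by
  have him : ∀ σ τ, (H σ τ).im = 0 := fun σ τ => by
    have h := congrArg Complex.im (hreal σ τ)
    rw [Complex.star_def, Complex.conj_im] at h
    linarith
  have hstep : ∀ σ τ, (ψ σ).re = 0 → σ ≠ τ → H σ τ ≠ 0 → (ψ τ).re = 0 := by
    intro σ τ h0 hne hH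
    have hψσ : ψ σ = 0 := Complex.ext (by rw [h0, Complex.zero_re]) (by rw [(hnn σ).2, Complex.zero_im])
    have hrow := congrFun hHψ σ
    rw [Pi.smul_apply, hψσ, smul_zero, mulVec, dotProduct] at hrow
    have hterm : ∀ ρ, (H σ ρ * ψ ρ).re ≤ 0 := by
      intro ρ
      by_cases hσρ : σ = ρ
      · subst hσρ
        rw [hψσ, mul_zero, Complex.zero_re]
      · rw [Complex.mul_re, him, (hnn ρ).2, mul_zero, sub_zero]
        exact mul_nonpos_of_nonpos_of_nonneg (hoff σ ρ hσρ) (hnn ρ).1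
    have hsum : ∑ ρ, (H σ ρ * ψ ρ).re = 0 := by rw [← Complex.re_sum, hrow, Complex.zero_re]
    have hz := (Finset.sum_eq_zero_iff_of_nonpos fun ρ _ => hterm ρ).1 hsum τ (Finset.mem_univ τ)
    rw [Complex.mul_re, him, (hnn τ).2, mul_zero, sub_zero] at hz
    rcases mul_eq_zero.1 hz with h | h
    · exact absurd (Complex.ext (by rw [h, Complex.zero_re]) (by rw [him, Complex.zero_im])) hH
    · exact h
  set ι := {σ : TensorIndex Λ (n + 1) // (∑ z, (σ z : ℕ)) = W}
  set B : Matrix ι ι ℂ := Matrix.of fun s t => if s = t then (1 : ℂ) else H s.1 t.1 with hBdef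
  have hBaux : ∀ s t : ι, heisenbergHamiltonian n G 1 s.1 t.1 ≠ 0 → B s t ≠ 0 := by
    intro s t hst
    by_cases hst' : s = t
    · rw [hBdef, Matrix.of_apply, if_pos hst']
      exact one_ne_zero
    · rw [hBdef, Matrix.of_apply, if_neg hst']
      exact hhop _ _ (fun h => hst' (Subtype.ext h)) hst
  have hprop : ∀ s t : ι, (ψ s.1).re = 0 → (ψ t.1).re = 0 := by
    intro s t hs
    have h := LiebMattis.reflTransGen_subtype n G 1 hG one_pos W hBaux s t
    induction h with
    | refl => exact hs
    | @tail b c _ hbc ih =>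
      by_cases hbc' : b = c
      · rw [← hbc']
        exact ih
      · rw [hBdef, Matrix.of_apply, if_neg hbc'] at hbc
        exact hstep _ _ ih (fun h => hbc' (Subtype.ext h)) hbc
  intro σ hσ
  rcases (hnn σ).1.lt_or_eq with h | h
  · exact h
  · exfalso
    apply hψ0
    funext τ
    by_cases hτ : (∑ z, (τ z : ℕ)) = W
    · exact Complex.ext (by rw [hprop ⟨σ, hσ⟩ ⟨τ, hτ⟩ h.symm, Pi.zero_apply, Complex.zero_re])
        (by rw [(hnn τ).2, Pi.zero_apply, Complex.zero_im])
    · rw [hψK τ hτ, Pi.zero_apply]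

/-- **The positive Perron vector of a sector** (any finite connected graph, any real `Δ`, weight `W`
attained): a sector ground vector `ψ₀` of `H(Δ)` with real non-negative entries, strictly positive on the
weight-`W` configurations and zero elsewhere, of which every sector ground vector is a multiple.
Tasaki (2020) §2.4; Lieb–Wu (2003) §2. [folklore] -/
theorem xxz_sector_perron_pos {Λ : Type*} [Fintype Λ] [DecidableEq Λ] (G : SimpleGraph Λ)
    [DecidableRel G.Adj] (hG : G.Connected) (Δ : ℝ) (W : ℕ)
    (hW : ∃ σ : TensorIndex Λ 2, (∑ z, (σ z : ℕ)) = W) :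
    ∃ ψ₀ : TensorIndex Λ 2 → ℂ,
      ψ₀ ∈ spinZSector (Λ := Λ) 1 (((Fintype.card Λ * 1 : ℕ) : ℝ) / 2 - W) ∧ ψ₀ ≠ 0 ∧
      (∀ σ, 0 ≤ (ψ₀ σ).re ∧ (ψ₀ σ).im = 0) ∧
      (∀ σ, (∑ z, (σ z : ℕ)) = W → 0 < (ψ₀ σ).re) ∧
      (∀ σ, (∑ z, (σ z : ℕ)) ≠ W → ψ₀ σ = 0) ∧
      xxzHamiltonian 1 G (-1) Δ *ᵥ ψ₀ =
        ((lowestEnergyInSector 1 (xxzHamiltonian 1 G (-1) Δ)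
          (((Fintype.card Λ * 1 : ℕ) : ℝ) / 2 - W) : ℝ) : ℂ) • ψ₀ ∧
      (∀ φ : TensorIndex Λ 2 → ℂ, φ ∈ spinZSector (Λ := Λ) 1 (((Fintype.card Λ * 1 : ℕ) : ℝ) / 2 - W) →
        xxzHamiltonian 1 G (-1) Δ *ᵥ φ =
          ((lowestEnergyInSector 1 (xxzHamiltonian 1 G (-1) Δ)
            (((Fintype.card Λ * 1 : ℕ) : ℝ) / 2 - W) : ℝ) : ℂ) • φ → ∃ c : ℂ, φ = c • ψ₀) := by
  obtain ⟨⟨ψ₀, hψ₀K, hψ₀0, hψ₀nn, hHψ₀⟩, huniq⟩ := xxz_sector_perronFrobenius G hG Δ W hW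
  have hent :=
    Summit.AtomisticToContinuum.BoseEinsteinCondensation.Cruxes.GroundStateStability.StableConeVariationalSelection.leadPF_entries
      G Δ (fun _ => (0 : ℝ))
  simp only [Complex.ofReal_zero, zero_smul, Finset.sum_const_zero, add_zero] at hent
  obtain ⟨happ, hreal, -, hoff, -⟩ := hent
  have hhop : ∀ σ τ : TensorIndex Λ 2, σ ≠ τ →
      heisenbergHamiltonian 1 G 1 σ τ ≠ 0 → xxzHamiltonian 1 G (-1) Δ σ τ ≠ 0 :=
    fun σ τ hστ h h0 => h (neg_eq_zero.1 ((happ σ τ hστ).symm.trans h0))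
  have hoffK : ∀ σ, (∑ z, (σ z : ℕ)) ≠ W → ψ₀ σ = 0 :=
    (LiebMattis.mem_spinZSector_weight_iff 1 W ψ₀).1 hψ₀K
  have hpos : ∀ σ, (∑ z, (σ z : ℕ)) = W → 0 < (ψ₀ σ).re :=
    groundVec_pos_of_nonneg 1 G hG _ hhop hreal hoff W hoffK hψ₀nn hHψ₀ hψ₀0
  exact ⟨ψ₀, hψ₀K, hψ₀0, hψ₀nn, hpos, hoffK, hHψ₀, fun φ hφ hHφ => huniq ψ₀ φ hψ₀K hφ hHψ₀ hHφ hψ₀0⟩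

/-! ### The class function on `K_{m,m}` -/

variable {m : ℕ}

/-- **The class function of a positive sector ground vector on `K_{m,m}`** (see the module docstring):
`ψ₀ = F ∘ A` on the weight-`W` sector, `F` vanishes on empty classes, is positive on nonempty ones,
mirror-symmetric, and satisfies the lumped birth–death equation.  Theory seat memo ROTOR-THEORY-6 §61;
Kemeny–Snell (1960) §6.3. [folklore] -/
theorem cb_classFun (hm : 0 < m) (Δ : ℝ) (W : ℕ) {E : ℝ} {ψ₀ : (Fin 2 × Fin m → Fin 2) → ℂ}
    (hK : ψ₀ ∈ spinZSector (Λ := Fin 2 × Fin m) 1 (((Fintype.card (Fin 2 × Fin m) * 1 : ℕ) : ℝ) / 2 - W))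
    (hnn : ∀ σ, 0 ≤ (ψ₀ σ).re ∧ (ψ₀ σ).im = 0)
    (hpos : ∀ σ, (∑ z, (σ z : ℕ)) = W → 0 < (ψ₀ σ).re)
    (hE : lowestEnergyInSector 1 (xxzHamiltonian 1 (SimpleGraph.completeEquipartiteGraph 2 m) (-1) Δ)
      (((Fintype.card (Fin 2 × Fin m) * 1 : ℕ) : ℝ) / 2 - W) = E)
    (hH : xxzHamiltonian 1 (SimpleGraph.completeEquipartiteGraph 2 m) (-1) Δ *ᵥ ψ₀ = ((E : ℝ) : ℂ) • ψ₀) :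
    ∃ F : ℕ → ℝ,
      (∀ τ : Fin 2 × Fin m → Fin 2, (∑ z, (τ z : ℕ)) = W →
        ψ₀ τ = ((F (Finset.univ.filter fun j : Fin m => τ (0, j) = 1).card : ℝ) : ℂ)) ∧
      (∀ a, (¬ ∃ τ : Fin 2 × Fin m → Fin 2, (∑ z, (τ z : ℕ)) = W ∧
        (Finset.univ.filter fun j : Fin m => τ (0, j) = 1).card = a) → F a = 0) ∧
      (∀ τ : Fin 2 × Fin m → Fin 2, (∑ z, (τ z : ℕ)) = W →
        0 < F (Finset.univ.filter fun j : Fin m => τ (0, j) = 1).card) ∧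
      (∀ a, a ≤ W → F (W - a) = F a) ∧
      (∀ a, (∃ τ : Fin 2 × Fin m → Fin 2, (∑ z, (τ z : ℕ)) = W ∧
          (Finset.univ.filter fun j : Fin m => τ (0, j) = 1).card = a) →
        E * F a = -(Δ * (((m : ℝ) / 2 - a) * ((m : ℝ) / 2 - ((W : ℝ) - a)))) * F a
          - (1 / 2) * ((a : ℝ) * ((m : ℝ) - ((W : ℝ) - a)) * F (a - 1)
            + ((m : ℝ) - a) * ((W : ℝ) - a) * F (a + 1))) := by
  classical
  set G := SimpleGraph.completeEquipartiteGraph 2 m with hGdef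
  have hHE : xxzHamiltonian 1 G (-1) Δ *ᵥ ψ₀ =
      ((lowestEnergyInSector 1 (xxzHamiltonian 1 G (-1) Δ)
        (((Fintype.card (Fin 2 × Fin m) * 1 : ℕ) : ℝ) / 2 - W) : ℝ) : ℂ) • ψ₀ := by rw [hE]; exact hH
  -- the class function
  let F : ℕ → ℝ := fun a =>
    if h : ∃ τ : Fin 2 × Fin m → Fin 2, (∑ z, (τ z : ℕ)) = W ∧
        (Finset.univ.filter fun j : Fin m => τ (0, j) = 1).card = a
    then (ψ₀ (Classical.choose h)).re else 0
  have hFdef : ∀ a (h : ∃ τ : Fin 2 × Fin m → Fin 2, (∑ z, (τ z : ℕ)) = W ∧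
      (Finset.univ.filter fun j : Fin m => τ (0, j) = 1).card = a),
      F a = (ψ₀ (Classical.choose h)).re := fun a h => by simp only [F, dif_pos h]
  -- `ψ₀` is constant on classes
  have hclass : ∀ τ τ' : Fin 2 × Fin m → Fin 2, (∑ z, (τ z : ℕ)) = W → (∑ z, (τ' z : ℕ)) = W →
      (Finset.univ.filter fun j : Fin m => τ (0, j) = 1).card =
        (Finset.univ.filter fun j : Fin m => τ' (0, j) = 1).card → ψ₀ τ = ψ₀ τ' := by
    intro τ τ' hτ hτ' h0
    have h1 : (Finset.univ.filter fun j : Fin m => τ (1, j) = 1).card =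
        (Finset.univ.filter fun j : Fin m => τ' (1, j) = 1).card := by
      have e1 := cb_weight_eq τ
      have e2 := cb_weight_eq τ'
      omega
    refine completeEquipartite_sectorGS_apply_eq (r := 2) (t := m) le_rfl hm Δ _ hK hHE ?_
    intro i
    rw [cb_partCount_eq_cnt, cb_partCount_eq_cnt]
    fin_cases i
    · exact h0
    · exact h1
  have hB1 : ∀ τ : Fin 2 × Fin m → Fin 2, (∑ z, (τ z : ℕ)) = W →
      ψ₀ τ = ((F (Finset.univ.filter fun j : Fin m => τ (0, j) = 1).card : ℝ) : ℂ) := by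
    intro τ hτ
    have h : ∃ τ' : Fin 2 × Fin m → Fin 2, (∑ z, (τ' z : ℕ)) = W ∧
        (Finset.univ.filter fun j : Fin m => τ' (0, j) = 1).card =
          (Finset.univ.filter fun j : Fin m => τ (0, j) = 1).card := ⟨τ, hτ, rfl⟩
    rw [hFdef _ h, hclass τ (Classical.choose h) hτ (Classical.choose_spec h).1 (Classical.choose_spec h).2.symm]
    exact Complex.ext (by simp) (by rw [Complex.ofReal_im]; exact (hnn _).2)
  refine ⟨F, hB1, ?_, ?_, ?_, ?_⟩
  · intro a ha
    simp only [F, dif_neg ha]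
  · intro τ hτ
    have h := hB1 τ hτ
    have hp := hpos τ hτ
    rw [h, Complex.ofReal_re] at hp
    exact hp
  · -- mirror symmetry via the part exchange
    intro a haW
    set π := Equiv.prodCongr (Equiv.swap (0 : Fin 2) 1) (Equiv.refl (Fin m)) with hπ
    have hmir : ∀ (a' : ℕ) (τ : Fin 2 × Fin m → Fin 2), (∑ z, (τ z : ℕ)) = W →
        (Finset.univ.filter fun j : Fin m => τ (0, j) = 1).card = a' →
        (∑ z, ((τ ∘ π) z : ℕ)) = W ∧
        (Finset.univ.filter fun j : Fin m => (τ ∘ π) (0, j) = 1).card = W - a' := by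
      intro a' τ hτ h0
      refine ⟨by rw [show (∑ z, ((τ ∘ π) z : ℕ)) = ∑ z, (τ z : ℕ) from Equiv.sum_comp π (fun z => (τ z : ℕ))]; exact hτ, ?_⟩
      rw [(cb_cnt_partSwap τ).1]
      have e := cb_weight_eq τ
      omega
    by_cases h : ∃ τ : Fin 2 × Fin m → Fin 2, (∑ z, (τ z : ℕ)) = W ∧
        (Finset.univ.filter fun j : Fin m => τ (0, j) = 1).card = a
    · obtain ⟨τ, hτ, h0⟩ := h
      obtain ⟨hτ', h0'⟩ := hmir a τ hτ h0
      have e1 := hB1 τ hτ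
      have e2 := hB1 (τ ∘ π) hτ'
      rw [h0] at e1
      rw [h0', cb_sectorGS_comp_partSwap hm Δ _ hK hHE τ, e1] at e2
      exact_mod_cast e2.symm
    · have h' : ¬ ∃ τ : Fin 2 × Fin m → Fin 2, (∑ z, (τ z : ℕ)) = W ∧
          (Finset.univ.filter fun j : Fin m => τ (0, j) = 1).card = W - a := by
        rintro ⟨τ, hτ, h0⟩
        obtain ⟨hτ', h0'⟩ := hmir (W - a) τ hτ h0
        exact h ⟨τ ∘ π, hτ', by rw [h0']; omega⟩
      simp only [F, dif_neg h, dif_neg h']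
  · -- the lumped equation on a nonempty class
    rintro a ⟨τ, hτ, h0⟩
    have hB : ((Finset.univ.filter fun j : Fin m => τ (1, j) = 1).card : ℝ) = (W : ℝ) - a := by
      have e := cb_weight_eq τ
      have : (Finset.univ.filter fun j : Fin m => τ (1, j) = 1).card = W - a := by omega
      rw [this, Nat.cast_sub (by omega)]
    have hm' : ∀ τ' : Fin 2 × Fin m → Fin 2,
        (Finset.univ.filter fun i : Fin m => τ' (0, i) = 1).card + 1 =
          (Finset.univ.filter fun i : Fin m => τ (0, i) = 1).card →
        (Finset.univ.filter fun i : Fin m => τ' (1, i) = 1).card =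
          (Finset.univ.filter fun i : Fin m => τ (1, i) = 1).card + 1 →
        ψ₀ τ' = ((F (a - 1) : ℝ) : ℂ) := by
      intro τ' ha' hb'
      have hw' : (∑ z, (τ' z : ℕ)) = W := by
        rw [cb_weight_eq] at hτ ⊢; omega
      rw [hB1 τ' hw']
      congr 2
      omega
    have hp' : ∀ τ' : Fin 2 × Fin m → Fin 2,
        (Finset.univ.filter fun i : Fin m => τ' (0, i) = 1).card =
          (Finset.univ.filter fun i : Fin m => τ (0, i) = 1).card + 1 →
        (Finset.univ.filter fun i : Fin m => τ' (1, i) = 1).card + 1 =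
          (Finset.univ.filter fun i : Fin m => τ (1, i) = 1).card →
        ψ₀ τ' = ((F (a + 1) : ℝ) : ℂ) := by
      intro τ' ha' hb'
      have hw' : (∑ z, (τ' z : ℕ)) = W := by
        rw [cb_weight_eq] at hτ ⊢; omega
      rw [hB1 τ' hw']
      congr 2
      omega
    have key := cb_lumped_equation Δ hH τ _ _ hm' hp'
    rw [hB1 τ hτ, h0] at key
    have hBc : ((Finset.univ.filter fun j : Fin m => τ (1, j) = 1).card : ℂ) = (((W : ℝ) - a : ℝ) : ℂ) := by
      exact_mod_cast congrArg (fun r : ℝ => (r : ℂ)) hB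
    rw [hBc] at key
    apply Complex.ofReal_injective
    push_cast at key ⊢
    linear_combination key

end Summit.HubbardSuperconductivity.HubbardSuperconductivity.Theorems.AnisotropyChord
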